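import Literature.AlgebraicGeometry.HodgeTheory.ChernCharacterBettiUniqueness
import Literature.AlgebraicGeometry.HodgeTheory.ProjectiveBundleTautologicalQuotientProof
import HarnessLib

/-!
# LEMMA U unconditionally: rigidity of twist-normalised Chern characters with all three inputs discharged

Family `hodge`, layer `Literature/AlgebraicGeometry/HodgeTheory`. HONEST FRAMING: nothing here constructs a
`ChernCharacterBetti`, asserts that one exists, or bears on any case of the Hodge conjecture.

`HodgeTheory/ChernCharacterBettiUniqueness` proves Grothendieck's uniqueness theorem for the hypothesis structure
`ChernCharacterBetti` — two twist-normalised theories `C`, `C'` satisfy `C'.chᵢ(E) = qⁱ • C.chᵢ(E)` (`q ∈ ℚˣ`, ONE `q`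
for all smooth projective `X`, all vector bundles `E`, all `i ≥ 1`) — GRANTED three printed inputs recorded as named
facts, two of which it discharges itself (§8 `RankLEOneDichotomy_holds`, §9 `LineBundleClassEqDifferenceOfPullbacks_holds`),
leaving its `''` editions conditional on `SplittingPrincipleBetti` alone. That last input is now a tree THEOREM:
`splittingPrincipleBetti_holds` (`HodgeTheory/ProjectiveBundleTautologicalQuotientProof`, from Grothendieck's splitting
construction `flagBundleSplitting_holds` — the incidence model of the projective bundle `P(G) ⊂ X × Gr₁`,
`Motives/ProjectiveBundleOfQuotient*` — and `splittingPrincipleBetti_of_flagBundleSplitting`: `f^*` is injective along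
a surjective morphism of smooth projective varieties, Voisin I Lemma 7.28). This file composes, so that LEMMA U and its
consumers (U4)–(U6) hold with NO hypothesis beyond twist-normalisation:

* `IsTwistNormalised.ch_eq_pow_smul` (U4, pointwise: given the hyperplane ratio `q`);
* `IsTwistNormalised.exists_ch_ratio'''` (LEMMA U packaged: `∃ q ≠ 0`, hyperplane classes AND all `chᵢ`, `i ≥ 1`);
* `IsTwistNormalised.exists_chPerfect_ratio` (U5: the same `q` scales `ch_p` of bounded complexes of vector bundles);
* `hasWeilClassDesignAt_iff_of_isTwistNormalised'''`, `hasBFSheafSeedAt_iff_of_isTwistNormalised'''` (U6: the anchor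
  predicates do not depend on the twist-normalised theory; the routes' `∀ C, C.IsTwistNormalised → …` binders may be
  checked on ONE `C`).

The primes continue the numbering of `ChernCharacterBettiUniqueness` (unprimed = three facts, `'` = two, `''` = one,
`'''` = none). SHARPNESS is unchanged (`IsTwistNormalised.rescale`: `q` cannot be removed, `q > 0` cannot be proved).

## References

* [Grothendieck1958] A. Grothendieck, La théorie des classes de Chern, Bull. SMF 86 (1958): Thm. 1 (unicité), §2.
* [Fulton1984] W. Fulton, Introduction to Intersection Theory in Algebraic Geometry, CBMS 54 (1984): §4.1.
* [Fulton1998] W. Fulton, Intersection Theory, 2nd ed. (1998): §3.2, §15.1, Example 15.3.2.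
* [Hartshorne1977] R. Hartshorne, Algebraic Geometry (1977): II §7 Prop. 7.10–7.12, II Thm. 7.1, II Ex. 5.8 (b).
* [VoisinHodgeI2002] C. Voisin, Hodge Theory and Complex Algebraic Geometry I (2002): Lemma 7.28, Lemma 7.32, Thm. 7.33.
* [BuchweitzFlenner2003] R.-O. Buchweitz, H. Flenner, A semiregularity map for modules and applications to
  deformations, Compositio Math. 137 (2003): §5 Thm. 5.1.
* Tree: `HodgeTheory/ChernCharacterBettiUniqueness` (§4–§6, §8–§10), `HodgeTheory/ProjectiveBundleTautologicalQuotientProof`.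
-/

noncomputable section

open CategoryTheory AlgebraicGeometry
open Literature.AlgebraicTopology.SingularHomology
open Literature.AlgebraicGeometry.Motives

namespace Literature.AlgebraicGeometry.HodgeTheory

section HodgeTheory

namespace ChernCharacterBetti

/-- **(U4) unconditionally: `C'.chᵢ(E) = qⁱ • C.chᵢ(E)` (`0 < i`) for every vector bundle on every smooth projective
complex variety**, for two twist-normalised theories whose hyperplane classes have ratio `q` — Grothendieck's
uniqueness argument with the splitting principle, Hartshorne II 7.1/7.6 and II Ex. 5.8 (b) all PROVED in the tree.
[cite: Grothendieck1958, Thm. 1 (uniqueness) and §2] [cite: Fulton1984, §4.1 (splitting principle)] -/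
theorem IsTwistNormalised.ch_eq_pow_smul {C C' : ChernCharacterBetti} (hC : C.IsTwistNormalised)
    (hC' : C'.IsTwistNormalised) {q : ℚ}
    (hq : ∀ N : ℕ, 1 ≤ N → C'.hyperplaneClass N = (q : ℂ) • C.hyperplaneClass N)
    {n : ℕ} {X : SchemeOver ℂ} (hX : IsSmoothProjective n X) (E : X.left.Modules) (hE : IsVectorBundle E)
    {i : ℕ} (hi : 0 < i) : C'.ch X E i = (q : ℂ) ^ i • C.ch X E i :=
  ChernCharacterBetti.ch_eq_pow_smul splittingPrincipleBetti_holds LineBundleClassEqDifferenceOfPullbacks_holds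
    RankLEOneDichotomy_holds hC hC' hq hX E hE hi

/-- **LEMMA U, unconditionally.** For two twist-normalised Chern character theories `C`, `C'` there is ONE `q ∈ ℚ`,
`q ≠ 0`, with `C'.H_N = q • C.H_N` (`N ≥ 1`) and `C'.chᵢ(E) = qⁱ • C.chᵢ(E)` for every vector bundle `E` on every smooth
projective complex variety and every `i ≥ 1` — no named fact remains (`'''` edition of `exists_ch_ratio`).
[cite: Grothendieck1958, Thm. 1 (uniqueness) and §2] [cite: Fulton1984, §4.1 (splitting principle)] -/
theorem IsTwistNormalised.exists_ch_ratio''' {C C' : ChernCharacterBetti} (hC : C.IsTwistNormalised)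
    (hC' : C'.IsTwistNormalised) :
    ∃ q : ℚ, q ≠ 0 ∧ (∀ N : ℕ, 1 ≤ N → C'.hyperplaneClass N = (q : ℂ) • C.hyperplaneClass N) ∧
      ∀ {n : ℕ} {X : SchemeOver ℂ}, IsSmoothProjective n X → ∀ (E : X.left.Modules), IsVectorBundle E →
        ∀ {i : ℕ}, 0 < i → C'.ch X E i = (q : ℂ) ^ i • C.ch X E i :=
  IsTwistNormalised.exists_ch_ratio'' splittingPrincipleBetti_holds hC hC'

/-- **(U5) unconditionally**: the same `q` scales the Chern character `chPerfect` of every bounded complex of vector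
bundles on a smooth projective variety, `ch_p(E•)' = qᵖ • ch_p(E•)` (`0 < p`), together with the hyperplane classes
and the `chᵢ` of vector bundles. [cite: Grothendieck1958, Thm. 1 (uniqueness)] [cite: Fulton1998, §15.1 and Example 3.2.3] -/
theorem IsTwistNormalised.exists_chPerfect_ratio {C C' : ChernCharacterBetti} (hC : C.IsTwistNormalised)
    (hC' : C'.IsTwistNormalised) :
    ∃ q : ℚ, q ≠ 0 ∧ (∀ N : ℕ, 1 ≤ N → C'.hyperplaneClass N = (q : ℂ) • C.hyperplaneClass N) ∧
      (∀ {n : ℕ} {X : SchemeOver ℂ}, IsSmoothProjective n X → ∀ (E : X.left.Modules), IsVectorBundle E →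
        ∀ {i : ℕ}, 0 < i → C'.ch X E i = (q : ℂ) ^ i • C.ch X E i) ∧
      ∀ {n : ℕ} {X : SchemeOver ℂ}, IsSmoothProjective n X → ∀ (E : CochainComplex X.left.Modules ℤ)
        (hE : ∀ j, IsFiniteLocallyFree (E.X j)) {p : ℕ}, 0 < p →
          chPerfect C' X E hE p = (q : ℂ) ^ p • chPerfect C X E hE p := by
  obtain ⟨q, hq0, hq, hch⟩ := hC.exists_ch_ratio''' hC'
  exact ⟨q, hq0, hq, hch, fun hX E hE _ hp => chPerfect_eq_pow_smul hch hX E hE hp⟩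

/-- **(U6a) unconditionally**: class-level designs at an anchor do not depend on the twist-normalised theory
(`0 < n`): `HasWeilClassDesignAt C n P h w ↔ HasWeilClassDesignAt C' n P h w`.
[cite: Grothendieck1958, Thm. 1 (uniqueness)] [cite: Fulton1998, Example 15.3.2 (PDF p. 286)] -/
theorem hasWeilClassDesignAt_iff_of_isTwistNormalised''' {C C' : ChernCharacterBetti}
    (hC : C.IsTwistNormalised) (hC' : C'.IsTwistNormalised) {n : ℕ} (hn : 0 < n) (P : AbelianVariety ℂ)
    (h : complexBetti P.X 2) (w : complexBetti P.X (2 * n)) :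
    HasWeilClassDesignAt C n P h w ↔ HasWeilClassDesignAt C' n P h w :=
  hasWeilClassDesignAt_iff_of_isTwistNormalised'' splittingPrincipleBetti_holds hC hC' hn P h w

/-- **(U6b) unconditionally**: Buchweitz–Flenner sheaf seeds at an anchor do not depend on the twist-normalised
theory (`0 < n`): `HasBFSheafSeedAt C n P h w ↔ HasBFSheafSeedAt C' n P h w` — the routes' binder
`∀ C, C.IsTwistNormalised → …` about seeds may be checked on ONE twist-normalised `C`.
[cite: Grothendieck1958, Thm. 1 (uniqueness)] [cite: BuchweitzFlenner2003, §5 Thm. 5.1] -/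
theorem hasBFSheafSeedAt_iff_of_isTwistNormalised''' {C C' : ChernCharacterBetti}
    (hC : C.IsTwistNormalised) (hC' : C'.IsTwistNormalised) {n : ℕ} (hn : 0 < n) (P : AbelianVariety ℂ)
    (h : complexBetti P.X 2) (w : complexBetti P.X (2 * n)) :
    HasBFSheafSeedAt C n P h w ↔ HasBFSheafSeedAt C' n P h w :=
  hasBFSheafSeedAt_iff_of_isTwistNormalised'' splittingPrincipleBetti_holds hC hC' hn P h w

end ChernCharacterBetti

end HodgeTheory

end Literature.AlgebraicGeometry.HodgeTheory

end
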